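import Mathlib
import HarnessLib
import Literature.Computability.AlgebraicComplexity.TensorRestrictionRank
import Literature.Computability.AlgebraicComplexity.FlatteningRank
import Summits.MatrixMultiplication.MatrixMultiplication.Theses.OutsiderSandwich
import Summits.MatrixMultiplication.MatrixMultiplication.Theorems.OutsiderSandwichDegenerationWitnessRestrictions

/-!
# OutsiderSandwich — LASER TANGENCY, Ib: LNT ⟹ LT (flattening of packings)
(decomp-mm lens 4, gen 10; part I `OutsiderSandwichLaserTangency.lean` holds the item's rungs and
necessity, part II `OutsiderSandwichLaserTangencyCut.lean` the exact cut)

* `packing_flattening`: `⟨B⟩ ⊗ ⟨m,m,m⟩ ≤ cw₂^{⊠N}` with `m ≥ 1` forces `B·m² ≤ 3^N`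
  (`ζ⁽¹⁾(⟨B⟩ ⊗ ⟨m,m,m⟩) = B·m²`, tree `flatteningRank_multiple_matMulTensor`; `ζ⁽¹⁾(cw₂^{⊠N}) ≤ 3^N`).
* `laserTangency_of_perfectBeyondLaser` = item `LaserTangencyOfPerfectBeyondLaser`
  (stmt-MatrixMultiplication-32269): LNT = `PerfectBeyondLaser` ⟹ LT = `LaserTangency`, with ONE cap
  `b = b_L − 2γ` serving every `s < 1`: an LNT packing (`B·m² ≥ 3^{(1−ε/4)N}`, `m ≥ 2^{(1/3+γ)N}`) has
  `B ≤ 3^N/m² ≤ 2^{(b_L − 2γ)N}` by flattening, and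
  `s·log B + 2 log m = s(log B + 2 log m) + (1−s)·2 log m ≥ s(1−ε/4)N log 3 + (1−s)(2/3 + 2γ)N log 2`.
  With gen 9's TOP ⟹ LNT (`perfectBeyondLaserOfMMPerfect_holds`): TOP ⟹ LNT ⟹ LT, so LT is
  WEAKER-OR-EQUAL than both earlier existence pieces of the route; the converse LT ⟹ LNT is the endpoint
  question (LNT is `LT(1)` up to ε-bookkeeping, LT is `∀ s < 1, LT(s)`) and is open.
Sources: Blaser2013 (Lemma 7.1 (2), flattening); BurgisserClausenShokrollahi1997 (§15.5);
CoppersmithWinograd1990 (§6).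
-/

set_option linter.dupNamespace false

namespace Summit.MatrixMultiplication.MatrixMultiplication.Theorems.OutsiderSandwichLaserTangencyOfPerfect

open scoped BigOperators
open Literature.Computability.AlgebraicComplexity
open Summit.MatrixMultiplication.MatrixMultiplication.Theses.OutsiderSandwich
  (PerfectBeyondLaser LaserTangency LaserTangencyOfPerfectBeyondLaser)
open Summit.MatrixMultiplication.MatrixMultiplication.Theorems.OutsiderSandwichDegenerationWitness
  (flatteningRank_le_card')

/-! ## Flattening of packings -/

/-- **Flattening of a packing**: `cw₂^{⊠N} ≥ ⟨B⟩ ⊗ ⟨m,m,m⟩` with `m ≥ 1` forces `B·m² ≤ 3^N`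
(`ζ⁽¹⁾(⟨B⟩ ⊗ ⟨m,m,m⟩) = B m²`, `ζ⁽¹⁾(cw₂^{⊠N}) ≤ 3^N`). [cite: Blaser2013, Lemma 7.1 (2) (proof)] -/
theorem packing_flattening {N B m : ℕ}
    (h : TensorRestrictsTo (kroneckerPow (cwTensor ℂ 2) N)
      (kroneckerTensor (unitTensor ℂ B) (matMulTensor ℂ m m m)))
    (hm : 0 < m) : B * m ^ 2 ≤ 3 ^ N := by
  have h1 := flatteningRank_mono h
  rw [flatteningRank_kroneckerPow, flatteningRank_multiple_matMulTensor (K := ℂ) B m m m hm] at h1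
  have h2 : flatteningRank (cwTensor ℂ 2) ≤ 3 := by
    simpa using flatteningRank_le_card' (cwTensor ℂ 2)
  calc B * m ^ 2 = B * (m * m) := by ring
    _ ≤ flatteningRank (cwTensor ℂ 2) ^ N := h1
    _ ≤ 3 ^ N := Nat.pow_le_pow_left h2 N

/-! ## LNT ⟹ LT -/

/-- **LNT ⟹ LT** with `b = log₂3 − 2/3 − 2γ`: an LNT packing has `B ≤ 3^N/m² ≤ 2^{(b_L − 2γ)N}`
(flattening) and excess ratio `1 − O(ε)` measured from its own multiplicity. [this route, g10] -/
theorem laserTangency_of_perfectBeyondLaser (h : PerfectBeyondLaser) : LaserTangency := by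
  obtain ⟨γ, hγ, hP⟩ := h
  intro s hs0 hs1
  refine ⟨Real.logb 2 3 - 2 / 3 - 2 * γ, by linarith, fun ε hε N₀ => ?_⟩
  have hε4 : 0 < ε / 4 := by positivity
  obtain ⟨N, hN, B, m, hres, hcap, hm⟩ := hP (ε / 4) hε4 N₀
  have hlog2 : 0 < Real.log 2 := Real.log_pos one_lt_two
  have hlog2gt : (1 : ℝ) / 2 < Real.log 2 := by linarith [Real.log_two_gt_d9]
  have hlog3 : 0 < Real.log 3 := Real.log_pos (by norm_num)
  have hlog3' : Real.log 3 ≤ 2 := by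
    rw [Real.log_le_iff_le_exp (by norm_num)]; linarith [Real.add_one_le_exp (2 : ℝ)]
  have hn0 : (0 : ℝ) ≤ N := Nat.cast_nonneg N
  have hL : Real.logb 2 3 * Real.log 2 = Real.log 3 := by
    rw [Real.logb, div_mul_cancel₀ _ hlog2.ne']
  have hLN : Real.logb 2 3 * N * Real.log 2 = N * Real.log 3 := by rw [← hL]; ring
  -- `m ≥ 1`, `B ≥ 1`
  have hm0 : (0 : ℝ) < m := lt_of_lt_of_le (Real.rpow_pos_of_pos two_pos _) hm
  have hmN : 0 < m := by exact_mod_cast hm0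
  have hB1 : 1 ≤ B := by
    by_contra hB
    have hB' : B = 0 := by omega
    rw [hB', Nat.cast_zero, zero_mul] at hcap
    linarith [Real.rpow_pos_of_pos (show (0 : ℝ) < 3 by norm_num) ((1 - ε / 4) * N)]
  have hB0 : (0 : ℝ) < B := by exact_mod_cast hB1
  -- logarithms
  have hL1 : (1 - ε / 4) * N * Real.log 3 ≤ Real.log B + 2 * Real.log m := by
    have := Real.log_le_log (by positivity) hcap
    rwa [Real.log_rpow (by norm_num), Real.log_mul hB0.ne' (by positivity), Real.log_pow] at this
  have hL2 : (1 / 3 + γ) * N * Real.log 2 ≤ Real.log m := by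
    have := Real.log_le_log (by positivity) hm
    rwa [Real.log_rpow (by norm_num)] at this
  have hflat : Real.log B + 2 * Real.log m ≤ N * Real.log 3 := by
    have h1 : B * m ^ 2 ≤ 3 ^ N := packing_flattening hres hmN
    have h2 : (B : ℝ) * (m : ℝ) ^ 2 ≤ (3 : ℝ) ^ N := by exact_mod_cast h1
    have := Real.log_le_log (by positivity) h2
    rwa [Real.log_mul hB0.ne' (by positivity), Real.log_pow, Real.log_pow] at this
  refine ⟨N, hN, B, m, hres, ?_, ?_⟩
  · rw [← Real.log_le_log_iff hB0 (Real.rpow_pos_of_pos two_pos _), Real.log_rpow two_pos]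
    linarith [hflat, hL2, hLN]
  · have lhs_pos : (0 : ℝ) < (2 : ℝ) ^ ((2 / 3 * (1 - s) - ε) * N) * (3 : ℝ) ^ (s * N) :=
      mul_pos (Real.rpow_pos_of_pos two_pos _) (Real.rpow_pos_of_pos (by norm_num) _)
    have rhs_pos : (0 : ℝ) < (B : ℝ) ^ s * (m : ℝ) ^ 2 :=
      mul_pos (Real.rpow_pos_of_pos hB0 s) (pow_pos hm0 2)
    rw [← Real.log_le_log_iff lhs_pos rhs_pos,
      Real.log_mul (Real.rpow_pos_of_pos two_pos _).ne' (Real.rpow_pos_of_pos (by norm_num) _).ne',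
      Real.log_rpow two_pos, Real.log_rpow (by norm_num : (0 : ℝ) < 3),
      Real.log_mul (Real.rpow_pos_of_pos hB0 s).ne' (pow_pos hm0 2).ne', Real.log_rpow hB0,
      Real.log_pow]
    have h1 : s * ((1 - ε / 4) * N * Real.log 3) ≤ s * (Real.log B + 2 * Real.log m) :=
      mul_le_mul_of_nonneg_left hL1 hs0.le
    have h2 : (1 - s) * (2 * ((1 / 3 + γ) * N * Real.log 2)) ≤ (1 - s) * (2 * Real.log m) :=
      mul_le_mul_of_nonneg_left (by linarith) (by linarith)
    have h3 : s * (ε / 4) * N * Real.log 3 ≤ ε * N * Real.log 2 := by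
      have h31 : s * Real.log 3 ≤ 1 * 2 := mul_le_mul hs1.le hlog3' hlog3.le zero_le_one
      have hεN : 0 ≤ ε * N := mul_nonneg hε.le hn0
      nlinarith [h31, hεN, hlog2gt, mul_le_mul_of_nonneg_left h31 hεN,
        mul_le_mul_of_nonneg_left hlog2gt.le hεN]
    have h4 : 0 ≤ (1 - s) * (γ * (N * Real.log 2)) :=
      mul_nonneg (by linarith) (mul_nonneg hγ.le (mul_nonneg hn0 hlog2.le))
    push_cast
    linarith [h1, h2, h3, h4]

/-! ## The route item, by name (rev 10) -/

/-- **Item `OutsiderSandwich.LaserTangencyOfPerfectBeyondLaser` (stmt-MatrixMultiplication-32269)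
holds**: LNT ⟹ LT. [this route, g10] -/
theorem laserTangencyOfPerfectBeyondLaser_holds : LaserTangencyOfPerfectBeyondLaser :=
  laserTangency_of_perfectBeyondLaser

end Summit.MatrixMultiplication.MatrixMultiplication.Theorems.OutsiderSandwichLaserTangencyOfPerfect
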